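import Summits.PneNP.PneNP.Theorems.ExpanderLinearGeneratorsColumnTwoBasic

/-!
# PneNP / ExpanderLinearGenerators — column weight two: connected row sets, balls, geodesics

Route `PneNP/ExpanderLinearGenerators`, support for crux stmt-PneNP-11443. Elementary connectivity
in the row multigraph of a scope family (`IsConn`, `nbr`, `ball` of `…ColumnTwoDefs`):

* `isConn_singleton`, `IsConn.union_of_adj`, `IsConn.union_of_inter`, `IsConn.union_nbrs` — unions
  of connected sets that touch are connected;
* `ball_subset`, `ball_mono_right`, `subset_ball`, `isConn_ball` — balls stay in the ambient set,
  grow, and are connected;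
* `exists_geodesic` — every row of `ball V W t` is joined to `W` by a connected set of `≤ t + 1`
  rows inside the ball;
* `card_ball_succ`, `le_card_ball_of_growth` — ball growth from neighbourhood bounds.

[folklore]
-/

namespace Summit.PneNP.PneNP.Theorems.ColumnTwo

open Finset Literature.Computability.MetaComplexity

variable {ι : Type*} [DecidableEq ι] {S : ι → Finset ℕ}

/-! ### Neighbourhoods -/

/-- Membership in the neighbourhood. [folklore] -/
theorem mem_nbr {V W : Finset ι} {j : ι} :
    j ∈ nbr S V W ↔ j ∈ V ∧ j ∉ W ∧ ∃ i ∈ W, (S i ∩ S j).Nonempty := by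
  rw [nbr, Finset.mem_filter, Finset.mem_sdiff, and_assoc]

/-- The neighbourhood inside a smaller ambient set is the trace of the neighbourhood. [folklore] -/
theorem nbr_mono_left {V V' W : Finset ι} (h : V ⊆ V') : nbr S V W ⊆ nbr S V' W := fun j hj => by
  rw [mem_nbr] at hj ⊢
  exact ⟨h hj.1, hj.2⟩

/-- Neighbours inside `V` versus inside `V'` with `V ⊆ V' `: the difference lies in `V' \\ V`.
[folklore] -/
theorem nbr_subset_nbr_union_sdiff (V V' W : Finset ι) :
    nbr S V' W ⊆ nbr S V W ∪ (V' \ V) := fun j hj => by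
  rw [mem_nbr] at hj
  by_cases hjV : j ∈ V
  · exact Finset.mem_union_left _ (mem_nbr.2 ⟨hjV, hj.2⟩)
  · exact Finset.mem_union_right _ (Finset.mem_sdiff.2 ⟨hj.1, hjV⟩)

omit [DecidableEq ι] in
/-- Adjacency is symmetric. [folklore] -/
theorem adj_symm {i j : ι} (h : (S i ∩ S j).Nonempty) : (S j ∩ S i).Nonempty := by
  rwa [Finset.inter_comm]

/-! ### Connected sets -/

/-- A singleton is connected. [folklore] -/
theorem isConn_singleton (v : ι) : IsConn S ({v} : Finset ι) := by
  intro W hW hne hWne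
  exfalso
  rcases Finset.subset_singleton_iff.1 hW with rfl | rfl
  · exact Finset.not_nonempty_empty hne
  · exact hWne rfl

/-- A technical form of connectivity: from a nonempty proper part one can step to a new row of the
set adjacent to the part. [folklore] -/
theorem IsConn.step {B W : Finset ι} (hB : IsConn S B) (hWB : W ⊆ B) (hne : W.Nonempty)
    (hWne : W ≠ B) : ∃ j ∈ B, j ∉ W ∧ ∃ i ∈ W, (S i ∩ S j).Nonempty := by
  obtain ⟨j, hj⟩ := hB W hWB hne hWne
  rw [mem_nbr] at hj
  exact ⟨j, hj.1, hj.2.1, hj.2.2⟩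

/-- **Union of two connected sets joined by an edge or a common row is connected.** [folklore] -/
theorem IsConn.union {A B : Finset ι} (hA : IsConn S A) (hB : IsConn S B)
    (hAB : (∃ a ∈ A, ∃ b ∈ B, (S a ∩ S b).Nonempty) ∨ (A ∩ B).Nonempty) : IsConn S (A ∪ B) := by
  -- one direction of the argument, for a part meeting `A`
  have key : ∀ {A B : Finset ι}, IsConn S A → IsConn S B →
      ((∃ a ∈ A, ∃ b ∈ B, (S a ∩ S b).Nonempty) ∨ (A ∩ B).Nonempty) →
      ∀ W ⊆ A ∪ B, (W ∩ A).Nonempty → W ≠ A ∪ B → (nbr S (A ∪ B) W).Nonempty := by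
    intro A B hA hB hAB W hW hWA hWne
    by_cases h1 : W ∩ A = A
    · -- `A ⊆ W`
      have hAW : A ⊆ W := fun a ha => (Finset.mem_inter.1 (h1.symm ▸ ha : a ∈ W ∩ A)).1
      by_cases h2 : (W ∩ B).Nonempty
      · have h3 : W ∩ B ≠ B := by
          intro h3
          apply hWne
          refine subset_antisymm hW (Finset.union_subset hAW fun b hb => ?_)
          exact (Finset.mem_inter.1 (h3.symm ▸ hb : b ∈ W ∩ B)).1
        obtain ⟨j, hjB, hjW, i, hi, hij⟩ := hB.step Finset.inter_subset_right h2 h3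
        refine ⟨j, mem_nbr.2 ⟨Finset.mem_union_right _ hjB, fun h => hjW ?_, i,
          (Finset.mem_inter.1 hi).1, hij⟩⟩
        exact Finset.mem_inter.2 ⟨h, hjB⟩
      · rw [Finset.not_nonempty_iff_eq_empty] at h2
        have hWeqA : W = A := by
          refine subset_antisymm (fun w hw => ?_) hAW
          rcases Finset.mem_union.1 (hW hw) with h | h
          · exact h
          · exact absurd (Finset.mem_inter.2 ⟨hw, h⟩) (by rw [h2]; exact Finset.notMem_empty _)
        subst hWeqA
        rcases hAB with ⟨a, ha, b, hb, hab⟩ | ⟨x, hx⟩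
        · have hbW : b ∉ W := fun h => by
            have : b ∈ W ∩ B := Finset.mem_inter.2 ⟨h, hb⟩
            rw [h2] at this; exact Finset.notMem_empty _ this
          exact ⟨b, mem_nbr.2 ⟨Finset.mem_union_right _ hb, hbW, a, ha, hab⟩⟩
        · have : x ∈ W ∩ B := hx
          rw [h2] at this; exact absurd this (Finset.notMem_empty _)
    · obtain ⟨j, hjA, hjW, i, hi, hij⟩ := hA.step Finset.inter_subset_right hWA h1
      refine ⟨j, mem_nbr.2 ⟨Finset.mem_union_left _ hjA, fun h => hjW ?_, i,
        (Finset.mem_inter.1 hi).1, hij⟩⟩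
      exact Finset.mem_inter.2 ⟨h, hjA⟩
  intro W hW hne hWne
  by_cases hWA : (W ∩ A).Nonempty
  · exact key hA hB hAB W hW hWA hWne
  · have hWB : (W ∩ B).Nonempty := by
      obtain ⟨w, hw⟩ := hne
      rcases Finset.mem_union.1 (hW hw) with h | h
      · exact absurd ⟨w, Finset.mem_inter.2 ⟨hw, h⟩⟩ hWA
      · exact ⟨w, Finset.mem_inter.2 ⟨hw, h⟩⟩
    have hAB' : (∃ a ∈ B, ∃ b ∈ A, (S a ∩ S b).Nonempty) ∨ (B ∩ A).Nonempty := by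
      rcases hAB with ⟨a, ha, b, hb, hab⟩ | h
      · exact Or.inl ⟨b, hb, a, ha, adj_symm hab⟩
      · exact Or.inr (by rwa [Finset.inter_comm])
    have := key hB hA hAB' W (by rwa [Finset.union_comm]) hWB (by rwa [Finset.union_comm])
    rwa [Finset.union_comm] at this

/-- **Adding rows each adjacent to a connected set keeps it connected.** [folklore] -/
theorem IsConn.union_nbrs {A N : Finset ι} (hA : IsConn S A)
    (hN : ∀ n ∈ N, ∃ a ∈ A, (S a ∩ S n).Nonempty) : IsConn S (A ∪ N) := by
  induction N using Finset.induction_on with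
  | empty => simpa using hA
  | insert x N hx ih =>
    have h1 : IsConn S (A ∪ N) := ih fun n hn => hN n (Finset.mem_insert_of_mem hn)
    obtain ⟨a, ha, hax⟩ := hN x (Finset.mem_insert_self x N)
    have h2 : IsConn S (A ∪ N ∪ {x}) :=
      h1.union (isConn_singleton x) (Or.inl ⟨a, Finset.mem_union_left _ ha, x, by simp, hax⟩)
    rwa [Finset.union_assoc, Finset.union_comm N, ← Finset.insert_eq] at h2

/-! ### Balls -/

/-- `ball V W 0 = W`. [folklore] -/
theorem ball_zero (V W : Finset ι) : ball S V W 0 = W := rfl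

/-- The successor ball. [folklore] -/
theorem ball_succ (V W : Finset ι) (t : ℕ) :
    ball S V W (t + 1) = ball S V W t ∪ nbr S V (ball S V W t) := rfl

/-- Balls around a subset of `V` stay inside `V`. [folklore] -/
theorem ball_subset {V W : Finset ι} (hW : W ⊆ V) (t : ℕ) : ball S V W t ⊆ V := by
  induction t with
  | zero => exact hW
  | succ t ih =>
    rw [ball_succ]
    exact Finset.union_subset ih ((nbr_subset_sdiff _ _).trans Finset.sdiff_subset)

/-- Balls grow with the radius. [folklore] -/
theorem ball_subset_succ (V W : Finset ι) (t : ℕ) : ball S V W t ⊆ ball S V W (t + 1) := by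
  rw [ball_succ]; exact Finset.subset_union_left

/-- Balls grow with the radius. [folklore] -/
theorem ball_mono {V W : Finset ι} {s t : ℕ} (h : s ≤ t) : ball S V W s ⊆ ball S V W t := by
  induction h with
  | refl => exact Finset.Subset.refl _
  | step _ ih => exact ih.trans (ball_subset_succ _ _ _)

/-- The centre lies in every ball. [folklore] -/
theorem subset_ball (V W : Finset ι) (t : ℕ) : W ⊆ ball S V W t := ball_mono (Nat.zero_le t)

/-- **Balls around a connected set are connected.** [folklore] -/
theorem isConn_ball {V W : Finset ι} (hW : IsConn S W) (t : ℕ) :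
    IsConn S (ball S V W t) := by
  induction t with
  | zero => exact hW
  | succ t ih =>
    rw [ball_succ]
    refine ih.union_nbrs fun n hn => ?_
    exact (mem_nbr.1 hn).2.2

/-- **Geodesics**: every row of the ball of radius `t` is joined to the centre by a connected set
of at most `t + 1` rows of the ball meeting the centre. [folklore] -/
theorem exists_geodesic {V W : Finset ι} {t : ℕ} {z : ι} (hz : z ∈ ball S V W t) :
    ∃ Q ⊆ ball S V W t, IsConn S Q ∧ z ∈ Q ∧ (Q ∩ W).Nonempty ∧ Q.card ≤ t + 1 := by
  induction t generalizing z with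
  | zero => exact ⟨{z}, by simpa [ball_zero] using hz, isConn_singleton z, by simp,
      ⟨z, by simpa [ball_zero] using hz⟩, by simp⟩
  | succ t ih =>
    rw [ball_succ, Finset.mem_union] at hz
    rcases hz with hz | hz
    · obtain ⟨Q, hQ, hc, hzQ, hQW, hcard⟩ := ih hz
      exact ⟨Q, hQ.trans (ball_subset_succ V W t), hc, hzQ, hQW, by omega⟩
    · obtain ⟨-, -, z', hz', hzz'⟩ := mem_nbr.1 hz
      obtain ⟨Q, hQ, hc, hz'Q, hQW, hcard⟩ := ih hz'
      refine ⟨insert z Q, ?_, ?_, Finset.mem_insert_self z Q, ?_, ?_⟩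
      · rw [Finset.insert_subset_iff]
        exact ⟨by rw [ball_succ]; exact Finset.mem_union_right _ hz,
          hQ.trans (ball_subset_succ V W t)⟩
      · have := hc.union (isConn_singleton z) (Or.inl ⟨z', hz'Q, z, by simp, hzz'⟩)
        rwa [Finset.union_comm, ← Finset.insert_eq] at this
      · exact hQW.mono (Finset.inter_subset_inter_right (Finset.subset_insert z Q))
      · exact (Finset.card_insert_le z Q).trans (by omega)

/-! ### Growth of balls -/

/-- One step of growth: if the ball has `≥ a` new neighbours then the next ball has `≥ a` more rows.
[folklore] -/
theorem card_ball_succ (V W : Finset ι) (t : ℕ) :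
    (ball S V W (t + 1)).card = (ball S V W t).card + (nbr S V (ball S V W t)).card := by
  rw [ball_succ, Finset.card_union_of_disjoint]
  exact Finset.disjoint_left.2 fun j hj hj' => (mem_nbr.1 hj').2.1 hj

/-- **Geometric growth**: if every `Y` with `W ⊆ Y ⊆ V` and `|Y| ≤ M` satisfies
`b |Y| ≤ a |nbr V Y|` (growth by the factor `(a+b)/a`), then for every `t`, either the ball of
radius `t` has more than `M` rows or `(a + b)^t |W| ≤ a^t |ball V W t|`. [folklore] -/
theorem le_card_ball_of_growth {V W : Finset ι} {a b M : ℕ}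
    (hgrow : ∀ Y, W ⊆ Y → Y ⊆ V → Y.card ≤ M → b * Y.card ≤ a * (nbr S V Y).card)
    (hW : W ⊆ V) (t : ℕ) :
    M < (ball S V W t).card ∨ (a + b) ^ t * W.card ≤ a ^ t * (ball S V W t).card := by
  induction t with
  | zero => exact Or.inr (by simp [ball_zero])
  | succ t ih =>
    by_cases hM : M < (ball S V W (t + 1)).card
    · exact Or.inl hM
    refine Or.inr ?_
    have hMt : (ball S V W t).card ≤ M :=
      (Finset.card_le_card (ball_subset_succ V W t)).trans (by omega)
    rcases ih with h | h
    · omega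
    have hg := hgrow (ball S V W t) (subset_ball V W t) (ball_subset hW t) hMt
    rw [card_ball_succ]
    calc (a + b) ^ (t + 1) * W.card = (a + b) * ((a + b) ^ t * W.card) := by ring
      _ ≤ (a + b) * (a ^ t * (ball S V W t).card) := Nat.mul_le_mul_left _ h
      _ = a ^ t * (a * (ball S V W t).card + b * (ball S V W t).card) := by ring
      _ ≤ a ^ t * (a * (ball S V W t).card + a * (nbr S V (ball S V W t)).card) := by gcongr
      _ = a ^ (t + 1) * ((ball S V W t).card + (nbr S V (ball S V W t)).card) := by ring

end Summit.PneNP.PneNP.Theorems.ColumnTwo
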